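import Summits.HodgeConjecture.HodgeConjecture.Theorems.Ring2WeilCoverageNormClassEq
import Summits.HodgeConjecture.HodgeConjecture.Theorems.Ring2WeilCoverageNormTableC
import HarnessLib

/-!
# Weil-type family coverage — product windows, part P: ONE-PARAMETER FAMILIES of trigonal / tetragonal Pryms on the TARGET rows
# R1, R2, R3, W6.3.10, W6.3.11, and the pillowcase row `n = 253` (`W6.3.253`)

research route conditional on HC_CM; not a corollary; Q11.4-sentence-2 already refuted in dim ≥ 3.

Ring 2, WEIL-TYPE FAMILY-COVERAGE CENSUS (`HOME/WEIL-FAMILY-COVERAGE.md` `## b04`, block b04.15 P.S. 2, owner ring2-b04, gen 51); sixteenth part of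
`Ring2WeilCoverageProductWindow` (same conventions as parts L–O; engines `symreal.py` / `polyrun.py` + `bigwin.py`; mirror
`HOME/pub-hodge-ring2-b04/census-g51/`).  LITERAL CLASSES for: (i) fibre-product data `Y = E ×_{ℙ¹} ℙ¹_φ` with `φ` a degree-`n` cover of `ℙ¹`
with FOUR branch values (three at the branch points of `E → ℙ¹`, one free: Hurwitz dimension 1 — a one-parameter family of curves `Y_t` of genus
7–9 whose `λ`-Pryms `B_t = P(Y_t/E)_λ` are `(3,3)` Weil sixfolds on the row; whether `B_t` MOVES is not decided here) on pub-hsemireg's TARGET rows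
R1 `= W6.3.2` (`n = 8`), R2 `= W6.3.5` (`n = 20`), R3 `= W6.1.3` (`n = 12`), and on `W6.3.10`, `W6.3.11` — data whose literal `det H` coincides with
an already-certified value (R1's family: `-8`, = parts K/L; W6.3.10's: `-32/5`, = part L) are not repeated; (ii) the uniform pillowcase polygon of
THEOREM S10 at `n = 253 = 11·23` (`K = ℚ(√-3)`; 759 sheets, kit j204908, 85 min): `(3,3)`, `det H = -192/253`, `T = {11, 23}` = `W6.3.253`, with the
row key `253 ∉ Nm(ℚ(√-3)ˣ)` (inert prime 11) proved in §0.

No `def`, no named fact, no `sorry`; nothing here is a statement about Hodge classes; `HC_CM` is used nowhere.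
References: [cite: vanGeemen1994HodgeAV, (5.4.1), Lemma 5.2]; [cite: Serre1973, Ch. III §1].
-/

set_option linter.dupNamespace false

open Literature.AlgebraicGeometry.Motives
open Literature.AlgebraicGeometry.VanGeemen1994
open Summit.HodgeConjecture.HodgeConjecture.Ring2.Hypotheses

namespace Summit.HodgeConjecture.HodgeConjecture.Ring2.WeilCoverage

namespace SqrtNeg3

/-- `253 ∉ Nm(ℚ(√-3)ˣ)`: descent at the inert prime `11` (`-3` is a non-square mod `11`, `11 ∥ 253 = 11·23`); `T(253) = {11, 23}` — the row key of
`W6.3.253`. research route conditional on HC_CM; not a corollary; Q11.4-sentence-2 already refuted in dim ≥ 3. [cite: Serre1973, Ch. III §1] -/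
theorem not_mem_253 : Units.mk0 (253 : ℚ) (by norm_num) ∉ normUnitsSubgroup ℚ (weilField 3) := by
  simpa using natCast_not_mem_normUnitsSubgroup_of_inert (d := 3) (a := 253) (p := 11)
    (by norm_num) (by decide) (by norm_num) (by norm_num) (by norm_num)

end SqrtNeg3

/-! ### §1 One-parameter families on R2, R3, W6.3.11 and the row `n = 253` -/

/-- FIBRE-PRODUCT datum `C3xS11` `(0; c1:10.1,c1:3^2.2^2.1,c1:3^3.1^2,c0:2.1^9)` (cycle types in `S11`; Hurwitz dimension 1 — a ONE-PARAMETER FAMILY; realised by explicit permutations with product one, generation: 2-transitive + Jordan (a 2-cycle as the 1-th power of a branch cycle, 2 <= n-3) => monodromy >= A_11): `Y = D ×_{ℙ¹} X` (genus 8; `D` the `C3`-quotient datum = the CM elliptic curve, `X` the degree-11 cover, genus 1), computed on its 33 sheets (engine `bigwin.py`, exact); the HIDDEN FACTOR `B` = the `λ`-part of the Prym `P(Y/D)` — an abelian SIXFOLD with `(3,3)` `ℚ(√-3)`-action, WEIL TYPE — has literal `det H|_B = -64/33`, `a = 64/33`, `T(a) = [3, 11]`: row `W6.3.11` (NON-split);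 `r₁ = dim_K H¹(D)_λ = 1`, `r_H = 7`. THEOREM S8 (Prym form of the product-window law, census b04.15 (A): `[a_B] = [n]^{r₁}`, no 2-transitivity needed) predicts `T(a_B) = [3, 11]` from `r₁ = 1`, `n = 11` — CONFIRMED.
research route conditional on HC_CM; not a corollary; Q11.4-sentence-2 already refuted in dim ≥ 3. [cite: vanGeemen1994HodgeAV, (5.4.1)] -/
theorem fibre_C3S11_n11_bbec5f_mk_detH_ne_split :
    (QuotientGroup.mk (Units.mk0 (((-64 : ℚ) / 33)) (by norm_num)) : weilNormResidueGroup 3) ≠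
      splitDiscriminantClass 3 3 := by
  have e : Units.mk0 (((-64 : ℚ) / 33)) (by norm_num) = -(Units.mk0 ((64 : ℚ) / 33) (by norm_num)) := Units.ext (by norm_num)
  rw [Ne, e, mk_neg_eq_splitDiscriminantClass_iff_of_odd (n := 3) (by decide)]
  have h := mul_not_mem_normUnitsSubgroup (mem_normUnitsSubgroup_of_sq_add_mul_sq (d := 3) (a := ((64 : ℚ) / 363)) (by norm_num) (0 : ℚ) ((8 : ℚ) / 33) (by norm_num))
    Summit.HodgeConjecture.Ring2WeilNormDescent.eleven_not_mem_norm_three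
  rw [mk0_mul_mk0] at h
  norm_num at h
  exact h

/-- The same datum, CELL IDENTIFICATION: `[det H|_B] = [-11]` in `ℚˣ/Nm(ℚ(√-3)ˣ)` — the census ROW KEY of `W6.3.11` (`a·11 = ((64 : ℚ) / 3) = ((0 : ℚ))² + 3·(((8 : ℚ) / 3))²`).
research route conditional on HC_CM; not a corollary; Q11.4-sentence-2 already refuted in dim ≥ 3. [cite: vanGeemen1994HodgeAV, Lemma 5.2 (3)] -/
theorem fibre_C3S11_n11_bbec5f_mk_detH_eq_key :
    (QuotientGroup.mk (Units.mk0 (-(((64 : ℚ) / 33))) (neg_ne_zero.2 (by norm_num))) : weilNormResidueGroup 3) =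
      QuotientGroup.mk (Units.mk0 (-(11 : ℚ)) (neg_ne_zero.2 (by norm_num))) :=
  mk_neg_eq_mk_neg_of_mul_mem (by norm_num) (by norm_num)
    (mem_normUnitsSubgroup_of_sq_add_mul_sq _ (0 : ℚ) ((8 : ℚ) / 3) (by norm_num))

/-- FIBRE-PRODUCT datum `C4xS12` `(0; c1:2^5.1^2,c1:11.1,c2:2^6,c0:2.1^10)` (cycle types in `S12`; Hurwitz dimension 1 — a ONE-PARAMETER FAMILY; realised by explicit permutations with product one, generation: 2-transitive + Jordan (a 2-cycle as the 1-th power of a branch cycle, 2 <= n-3) => monodromy >= A_12): `Y = D ×_{ℙ¹} X` (genus 8; `D` the `C4`-quotient datum = the CM elliptic curve, `X` the degree-12 cover, genus 0), computed on its 48 sheets (engine `bigwin.py`, exact); the HIDDEN FACTOR `B` = the `λ`-part of the Prym `P(Y/D)` — an abelian SIXFOLD with `(3,3)` `ℚ(√-1)`-action, WEIL TYPE — has literal `det H|_B = -1/6`, `a = 1/6`, `T(a) = [2, 3]`: row `W6.1.3` (NON-split); `r₁ = dim_K H¹(D)_λ = 1`, `r_H = 7`. THEOREM S8 (Prym form of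 the product-window law, census b04.15 (A): `[a_B] = [n]^{r₁}`, no 2-transitivity needed) predicts `T(a_B) = [2, 3]` from `r₁ = 1`, `n = 12` — CONFIRMED.
research route conditional on HC_CM; not a corollary; Q11.4-sentence-2 already refuted in dim ≥ 3. [cite: vanGeemen1994HodgeAV, (5.4.1)] -/
theorem fibre_C4S12_n12_456ecc_mk_detH_ne_split :
    (QuotientGroup.mk (Units.mk0 (((-1 : ℚ) / 6)) (by norm_num)) : weilNormResidueGroup 1) ≠
      splitDiscriminantClass 3 1 := by
  have e : Units.mk0 (((-1 : ℚ) / 6)) (by norm_num) = -(Units.mk0 ((1 : ℚ) / 6) (by norm_num)) := Units.ext (by norm_num)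
  rw [Ne, e, mk_neg_eq_splitDiscriminantClass_iff_of_odd (n := 3) (by decide)]
  have h := mul_not_mem_normUnitsSubgroup (mem_normUnitsSubgroup_of_sq_add_mul_sq (d := 1) (a := ((1 : ℚ) / 18)) (by norm_num) ((1 : ℚ) / 6) ((1 : ℚ) / 6) (by norm_num))
    Summit.HodgeConjecture.Ring2WeilNormDescent.three_not_mem_norm_one
  rw [mk0_mul_mk0] at h
  norm_num at h
  exact h

/-- The same datum, CELL IDENTIFICATION: `[det H|_B] = [-3]` in `ℚˣ/Nm(ℚ(√-1)ˣ)` — the census ROW KEY of `W6.1.3` (`a·3 = ((1 : ℚ) / 2) = (((1 : ℚ) / 2))² + 1·(((1 : ℚ) / 2))²`).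
research route conditional on HC_CM; not a corollary; Q11.4-sentence-2 already refuted in dim ≥ 3. [cite: vanGeemen1994HodgeAV, Lemma 5.2 (3)] -/
theorem fibre_C4S12_n12_456ecc_mk_detH_eq_key :
    (QuotientGroup.mk (Units.mk0 (-(((1 : ℚ) / 6))) (neg_ne_zero.2 (by norm_num))) : weilNormResidueGroup 1) =
      QuotientGroup.mk (Units.mk0 (-(3 : ℚ)) (neg_ne_zero.2 (by norm_num))) :=
  mk_neg_eq_mk_neg_of_mul_mem (by norm_num) (by norm_num)
    (mem_normUnitsSubgroup_of_sq_add_mul_sq _ ((1 : ℚ) / 2) ((1 : ℚ) / 2) (by norm_num))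

/-- FIBRE-PRODUCT datum `C3xS20` `(0; c1:15.3.2,c1:3^6.1^2,c1:3^6.1^2,c0:2.1^18)` (cycle types in `S20`; Hurwitz dimension 1 — a ONE-PARAMETER FAMILY; realised by explicit permutations with product one, generation: 2-transitive + Jordan (a 2-cycle as the 1-th power of a branch cycle, 2 <= n-3) => monodromy >= A_20): `Y = D ×_{ℙ¹} X` (genus 9; `D` the `C3`-quotient datum = the CM elliptic curve, `X` the degree-20 cover, genus 2), computed on its 60 sheets (engine `bigwin.py`, exact); the HIDDEN FACTOR `B` = the `λ`-part of the Prym `P(Y/D)` — an abelian SIXFOLD with `(3,3)` `ℚ(√-3)`-action, WEIL TYPE — has literal `det H|_B = -16/45`, `a = 16/45`, `T(a) = [3, 5]`: row `W6.3.5` (NON-split); `r₁ = dim_K H¹(D)_λ = 1`, `r_H = 7`. THEOREM S8 (Prym form of the product-window law, census b04.15 (A): `[a_B] = [n]^{r₁}`, no 2-transitivity needed) predicts `T(a_B) = [3, 5]` from `r₁ = 1`, `n = 20` — CONFIRMED.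
research route conditional on HC_CM; not a corollary; Q11.4-sentence-2 already refuted in dim ≥ 3. [cite: vanGeemen1994HodgeAV, (5.4.1)] -/
theorem fibre_C3S20_n20_0a6d49_mk_detH_ne_split :
    (QuotientGroup.mk (Units.mk0 (((-16 : ℚ) / 45)) (by norm_num)) : weilNormResidueGroup 3) ≠
      splitDiscriminantClass 3 3 := by
  have e : Units.mk0 (((-16 : ℚ) / 45)) (by norm_num) = -(Units.mk0 ((16 : ℚ) / 45) (by norm_num)) := Units.ext (by norm_num)
  rw [Ne, e, mk_neg_eq_splitDiscriminantClass_iff_of_odd (n := 3) (by decide)]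
  have h := mul_not_mem_normUnitsSubgroup (mem_normUnitsSubgroup_of_sq_add_mul_sq (d := 3) (a := ((16 : ℚ) / 225)) (by norm_num) ((4 : ℚ) / 15) (0 : ℚ) (by norm_num))
    Summit.HodgeConjecture.Ring2WeilNormDescent.five_not_mem_norm_three
  rw [mk0_mul_mk0] at h
  norm_num at h
  exact h

/-- The same datum, CELL IDENTIFICATION: `[det H|_B] = [-5]` in `ℚˣ/Nm(ℚ(√-3)ˣ)` — the census ROW KEY of `W6.3.5` (`a·5 = ((16 : ℚ) / 9) = (((4 : ℚ) / 3))² + 3·((0 : ℚ))²`).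
research route conditional on HC_CM; not a corollary; Q11.4-sentence-2 already refuted in dim ≥ 3. [cite: vanGeemen1994HodgeAV, Lemma 5.2 (3)] -/
theorem fibre_C3S20_n20_0a6d49_mk_detH_eq_key :
    (QuotientGroup.mk (Units.mk0 (-(((16 : ℚ) / 45))) (neg_ne_zero.2 (by norm_num))) : weilNormResidueGroup 3) =
      QuotientGroup.mk (Units.mk0 (-(5 : ℚ)) (neg_ne_zero.2 (by norm_num))) :=
  mk_neg_eq_mk_neg_of_mul_mem (by norm_num) (by norm_num)
    (mem_normUnitsSubgroup_of_sq_add_mul_sq _ ((4 : ℚ) / 3) (0 : ℚ) (by norm_num))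

/-- FIBRE-PRODUCT datum `C3xS11` `(0; c1:10.1,c1:3.2^3.1^2,c1:3^3.1^2)` (cycle types in `S11`; Hurwitz dimension 0; realised by explicit permutations with product one, generation: 2-transitive + Jordan (a 3-cycle as the 2-th power of a branch cycle, 3 <= n-3) => monodromy >= A_11): `Y = D ×_{ℙ¹} X` (genus 7; `D` the `C3`-quotient datum = the CM elliptic curve, `X` the degree-11 cover, genus 0), computed on its 33 sheets (engine `bigwin.py`, exact); the HIDDEN FACTOR `B` = the `λ`-part of the Prym `P(Y/D)` — an abelian SIXFOLD with `(3,3)` `ℚ(√-3)`-action, WEIL TYPE — has literal `det H|_B = -64/11`, `a = 64/11`, `T(a) = [3, 11]`: row `W6.3.11` (NON-split); `r₁ = dim_K H¹(D)_λ = 1`, `r_H = 7`. THEOREM S8 (Prym form of the product-window law, census b04.15 (A): `[a_B] = [n]^{r₁}`, no 2-transitivity needed) predicts `T(a_B) = [3, 11]` from `r₁ = 1`, `n = 11` — CONFIRMED.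
research route conditional on HC_CM; not a corollary; Q11.4-sentence-2 already refuted in dim ≥ 3. [cite: vanGeemen1994HodgeAV, (5.4.1)] -/
theorem fibre_C3S11_n11_b4d6cc_mk_detH_ne_split :
    (QuotientGroup.mk (Units.mk0 (((-64 : ℚ) / 11)) (by norm_num)) : weilNormResidueGroup 3) ≠
      splitDiscriminantClass 3 3 := by
  have e : Units.mk0 (((-64 : ℚ) / 11)) (by norm_num) = -(Units.mk0 ((64 : ℚ) / 11) (by norm_num)) := Units.ext (by norm_num)
  rw [Ne, e, mk_neg_eq_splitDiscriminantClass_iff_of_odd (n := 3) (by decide)]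
  have h := mul_not_mem_normUnitsSubgroup (mem_normUnitsSubgroup_of_sq_add_mul_sq (d := 3) (a := ((64 : ℚ) / 121)) (by norm_num) ((8 : ℚ) / 11) (0 : ℚ) (by norm_num))
    Summit.HodgeConjecture.Ring2WeilNormDescent.eleven_not_mem_norm_three
  rw [mk0_mul_mk0] at h
  norm_num at h
  exact h

/-- The same datum, CELL IDENTIFICATION: `[det H|_B] = [-11]` in `ℚˣ/Nm(ℚ(√-3)ˣ)` — the census ROW KEY of `W6.3.11` (`a·11 = (64 : ℚ) = ((8 : ℚ))² + 3·((0 : ℚ))²`).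
research route conditional on HC_CM; not a corollary; Q11.4-sentence-2 already refuted in dim ≥ 3. [cite: vanGeemen1994HodgeAV, Lemma 5.2 (3)] -/
theorem fibre_C3S11_n11_b4d6cc_mk_detH_eq_key :
    (QuotientGroup.mk (Units.mk0 (-(((64 : ℚ) / 11))) (neg_ne_zero.2 (by norm_num))) : weilNormResidueGroup 3) =
      QuotientGroup.mk (Units.mk0 (-(11 : ℚ)) (neg_ne_zero.2 (by norm_num))) :=
  mk_neg_eq_mk_neg_of_mul_mem (by norm_num) (by norm_num)
    (mem_normUnitsSubgroup_of_sq_add_mul_sq _ (8 : ℚ) (0 : ℚ) (by norm_num))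

/-- PILLOWCASE datum (A₂ alcove lattice, orbifold `ℙ¹(3,3,3) = E_ω/C₃`): the double of the lattice 9-gon `P` with turning sequence `-1,-1,-1,+2,+1,+1,+1,+2,+2` (×60°) and side lengths `1,1,1,122,1,122,2,3,2` is a Belyi map `φ_P : ℙ¹ → ℙ¹` of degree `n = 253` (= number of alcoves of `P`) with passport `(4.3^82.2.1, 4^2.3^80.2^2.1, 3^84.1)` and monodromy group `A253` (certified: randomized Schreier–Sims lower bound = the full order); `Y_P : y³ = φ_P(φ_P − 1)` (genus 7) is the normalised fibre product `E ×_{ℙ¹} ℙ¹_{φ_P}` (759 sheets over `ℙ¹`; engine `bigwin.py`, exact) and the HIDDEN FACTOR `B` = the `λ`-part of the Prym `P(Y_P/E)` — an abelian SIXFOLD with `(3,3)` `ℚ(√-3)`-action, WEIL TYPE — has literal `det H|_B = -192/253`, `a = 192/253`, `T(a) = [11, 23]`: row `W6.3.253` (NON-split); `r₁ = dim_K H¹(D)_λ = 1`, `r_H = 7`. THEOREM S8 (Prym form of the product-window law, census b04.15 (A): `[a_B] = [n]^{r₁}`, no 2-transitivity needed) predicts `T(a_B) = [11, 23]` from `r₁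 = 1`, `n = 253` — CONFIRMED.
research route conditional on HC_CM; not a corollary; Q11.4-sentence-2 already refuted in dim ≥ 3. [cite: vanGeemen1994HodgeAV, (5.4.1)] -/
theorem pillow3_C3A253_n253_613369_mk_detH_ne_split :
    (QuotientGroup.mk (Units.mk0 (((-192 : ℚ) / 253)) (by norm_num)) : weilNormResidueGroup 3) ≠
      splitDiscriminantClass 3 3 := by
  have e : Units.mk0 (((-192 : ℚ) / 253)) (by norm_num) = -(Units.mk0 ((192 : ℚ) / 253) (by norm_num)) := Units.ext (by norm_num)
  rw [Ne, e, mk_neg_eq_splitDiscriminantClass_iff_of_odd (n := 3) (by decide)]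
  have h := mul_not_mem_normUnitsSubgroup (mem_normUnitsSubgroup_of_sq_add_mul_sq (d := 3) (a := ((192 : ℚ) / 64009)) (by norm_num) (0 : ℚ) ((8 : ℚ) / 253) (by norm_num))
    SqrtNeg3.not_mem_253
  rw [mk0_mul_mk0] at h
  norm_num at h
  exact h

/-- The same datum, CELL IDENTIFICATION: `[det H|_B] = [-253]` in `ℚˣ/Nm(ℚ(√-3)ˣ)` — the census ROW KEY of `W6.3.253` (`a·253 = (192 : ℚ) = ((0 : ℚ))² + 3·((8 : ℚ))²`).
research route conditional on HC_CM; not a corollary; Q11.4-sentence-2 already refuted in dim ≥ 3. [cite: vanGeemen1994HodgeAV, Lemma 5.2 (3)] -/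
theorem pillow3_C3A253_n253_613369_mk_detH_eq_key :
    (QuotientGroup.mk (Units.mk0 (-(((192 : ℚ) / 253))) (neg_ne_zero.2 (by norm_num))) : weilNormResidueGroup 3) =
      QuotientGroup.mk (Units.mk0 (-(253 : ℚ)) (neg_ne_zero.2 (by norm_num))) :=
  mk_neg_eq_mk_neg_of_mul_mem (by norm_num) (by norm_num)
    (mem_normUnitsSubgroup_of_sq_add_mul_sq _ (0 : ℚ) (8 : ℚ) (by norm_num))

end Summit.HodgeConjecture.HodgeConjecture.Ring2.WeilCoverage
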